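import Literature.NumberTheory.Sieve.FriedlanderIwaniecPrimesGaussianSector
import Mathlib.Analysis.SpecialFunctions.SmoothTransition
import HarnessLib

/-!
# Friedlander–Iwaniec, *The polynomial `X² + Y⁴` captures its primes*, §5: Cauchy's inequality (5.17)–(5.20)

Family `parity`, statement parity.S17. Source: J. Friedlander, H. Iwaniec, Ann. of Math. (2) 148
(1998), 945–1040 [FriedlanderIwaniecAnnals1998], §5 "The bilinear form in the sieve:
Transformations", (5.17)–(5.20): "Recall that `α_w` are bounded numbers with `|w|²` in the dyadic
segment (4.18). By Cauchy's inequality (5.17) `B²(M, N) ≪ M 𝒟(M, N)` where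
(5.18) `𝒟(M, N) = Σ_w f(w) |Σ_z β_z 𝔷(Re w̄ z)|²`. Here we have introduced a smooth majorant `f` to
simplify the forthcoming harmonic analysis. We choose an `f` that is supported in the annulus
(5.19) `½ √M ≤ |w| ≤ 2 √M`. Also, it is convenient to take `f` to be radial, that is
`f(w) = f(|w|)`. Now we need to prove that (5.20) `𝒟(M, N) ≪ ϑ² θ⁴ M^{1/2} N^{3/2} (log MN)⁸`."

Everything in this file is PROVED. It is the first step of the reduction of (5.15) — the bound
`B(M, N) ≪ ϑ θ² (MN)^{3/4} (log MN)⁴` for the free sector forms `fiGaussSector` of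
`FriedlanderIwaniecPrimesGaussianSector`, to which (4.23) (the hypothesis `BilinBoundAt` of
`FriedlanderIwaniec1998_prop41_of_bilinear423`, `FriedlanderIwaniecPrimesBilinearReduction`) reduces by
(5.7)–(5.16) — to the deeper statements
of the source: here (5.15) ⇐ (5.20). (5.15) and (5.20) are displayed reduction steps, not numbered
results, so they are formalised as PARAMETRISED statements (`Bilinear515With`,
`DispersionBoundWith`: explicit binders for the regime `η, A, A₁` and the parameters `A', t, B, K`),
never as named facts; the theorems are implications between them. The planned sequels (this unit)
continue with (5.20) ⇐ (5.25) (Lemma 5.1, (5.21)–(5.24)) and (5.25) ⇐ (10.10) + Proposition 10.2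
(§§6–10: the lattice-point analysis of `C(z₁, z₂)`, Lemmata 7.1–7.2, 8.1–8.4, 9.1, 10.1), so that
(5.15) — and through (4.23) and `FriedlanderIwaniec1998_prop41_of_bilinear423`, parity.S17 — rest
on Proposition 10.2 (§§11–26).

## Contents

* `fiRad M` — the radial profile `𝔣` of the majorant `f(w) = 𝔣(|w|²)`: the explicit smooth function
  `u ↦ ψ((4u - M)/M) ψ((4M - u)/(2M))` (`ψ = Real.smoothTransition`), equal to `1` on `[M/2, 2M]`,
  vanishing off `(M/4, 4M)`, with values in `[0, 1]` (`fiRad_eq_one`, `fiRad_eq_zero_of_le`,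
  `fiRad_eq_zero_of_ge`, `fiRad_nonneg`, `fiRad_le_one`, `contDiff_fiRad`);
* `fiSectorInner q p z₀ N' θ C P τ w` — the inner sum `Σ_z β_z 𝔷(Re w̄ z)` of (5.18) with the
  coefficients (5.13) under the conventions (5.7)–(5.9) (real valued);
* `fiDispersion q p z₀ M N' θ C P τ` — `𝒟(M, N)` of (5.18) with `f(w) = fiRad M (|w|²)`, the sum
  over `w` grouped by `m = |w|²`;
* the regime predicates `FISectorRegime` (the ranges (4.4), (4.6), (4.19)⁺, `1 ≤ C ≤ N^{1-η}`,
  `N < N' < 2N`), `FICutoff` ((4.12)–(4.14) for `p`), `FISectorCutoff` ((5.12) for `q`, sector away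
  from the axes), and the parametrised statements `Bilinear515With η A A₁ A' t B K` ((5.15) in a
  given regime with given parameters; `Bilinear515With.apply` unbundles it into the quantifier
  shape of `BilinBoundAt`, the (4.23)-hypothesis of `…BilinearReduction`) and
  `DispersionBoundWith η A A₁ A' t B K` ((5.20)
  likewise);
* `fiGaussSector_eq_sum_inner` (`B(M, N) = Σ_m α(m) Σ_{|w|² = m} S(w)`),
  `norm_fiGaussSector_sq_le` ((5.17): `‖B(M, N)‖² ≤ 15 M 𝒟(M, N)` for `M ≥ 1`),
  `bilinear515With_of_dispersionBoundWith` and `bilinear515_of_dispersion` ((5.15) ⇐ (5.20), with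
  `K ↦ √(15K)`).

## References

* J. Friedlander, H. Iwaniec, Ann. of Math. (2) 148 (1998), 945–1040, §5 (5.15)–(5.20), §7 (the
  profile `𝔣`). [FriedlanderIwaniecAnnals1998]

## Tree / Mathlib

Tree: `fiGaussSector`, `gaussArg`, `GaussCongrEight` (`…GaussianSector`); `sqPairs`, `mem_sqPairs`, `toGauss`, `fiZeta` (`…GaussianParam`); `fiBeta`
(`…BilinearForm`); `primaryNormEq` (`QuadraticFields.GaussianPrimary`). Mathlib:
`Real.smoothTransition`, `Finset.sum_mul_sq_le_sq_mul_sq`, `Finset.card_biUnion`.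
-/

noncomputable section

open Filter Finset Real
open Literature.NumberTheory.QuadraticFields.GaussianPrimary

namespace Literature.NumberTheory.Sieve

namespace FriedlanderIwaniecPrimes

/-! ### The radial majorant -/

/-- The radial profile `𝔣 = 𝔣_M` of the smooth majorant `f(w) = 𝔣(|w|²)` of (5.18)–(5.19) and §7:
`𝔣(u) = ψ((4u - M)/M) · ψ((4M - u)/(2M))` with `ψ` Mathlib's `Real.smoothTransition`; it is smooth,
`= 1` on `[M/2, 2M]`, `= 0` off `(M/4, 4M)`, with values in `[0, 1]`.
[cite: FriedlanderIwaniecAnnals1998, (5.18)-(5.19) and §7] -/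
def fiRad (M : ℝ) (u : ℝ) : ℝ :=
  Real.smoothTransition ((4 * u - M) / M) * Real.smoothTransition ((4 * M - u) / (2 * M))

/-- `fiRad` unfolded. [cite: FriedlanderIwaniecAnnals1998, (5.19)] -/
theorem fiRad_def (M u : ℝ) : fiRad M u =
    Real.smoothTransition ((4 * u - M) / M) * Real.smoothTransition ((4 * M - u) / (2 * M)) := rfl

/-- `0 ≤ 𝔣`. [folklore] -/
theorem fiRad_nonneg (M u : ℝ) : 0 ≤ fiRad M u :=
  mul_nonneg (Real.smoothTransition.nonneg _) (Real.smoothTransition.nonneg _)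

/-- `𝔣 ≤ 1`. [folklore] -/
theorem fiRad_le_one (M u : ℝ) : fiRad M u ≤ 1 := by
  unfold fiRad
  calc Real.smoothTransition ((4 * u - M) / M) * Real.smoothTransition ((4 * M - u) / (2 * M))
      ≤ 1 * 1 := mul_le_mul (Real.smoothTransition.le_one _) (Real.smoothTransition.le_one _)
          (Real.smoothTransition.nonneg _) zero_le_one
    _ = 1 := one_mul _

/-- `𝔣 = 1` on `[M/2, 2M]` (so `f` majorises the indicator of `M < |w|² ≤ 2M`). [folklore] -/
theorem fiRad_eq_one {M u : ℝ} (hM : 0 < M) (h1 : M / 2 ≤ u) (h2 : u ≤ 2 * M) : fiRad M u = 1 := by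
  unfold fiRad
  have ha : 1 ≤ (4 * u - M) / M := by
    rw [le_div_iff₀ hM]; linarith
  have hb : 1 ≤ (4 * M - u) / (2 * M) := by
    rw [le_div_iff₀ (by positivity)]; linarith
  rw [Real.smoothTransition.one_of_one_le ha, Real.smoothTransition.one_of_one_le hb, one_mul]

/-- `𝔣 = 0` for `u ≤ M/4`. [folklore] -/
theorem fiRad_eq_zero_of_le {M u : ℝ} (hM : 0 < M) (h : u ≤ M / 4) : fiRad M u = 0 := by
  unfold fiRad
  have ha : (4 * u - M) / M ≤ 0 := div_nonpos_of_nonpos_of_nonneg (by linarith) hM.le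
  rw [Real.smoothTransition.zero_of_nonpos ha, zero_mul]

/-- `𝔣 = 0` for `u ≥ 4M`. [folklore] -/
theorem fiRad_eq_zero_of_ge {M u : ℝ} (hM : 0 < M) (h : 4 * M ≤ u) : fiRad M u = 0 := by
  unfold fiRad
  have hb : (4 * M - u) / (2 * M) ≤ 0 := div_nonpos_of_nonpos_of_nonneg (by linarith) (by positivity)
  rw [Real.smoothTransition.zero_of_nonpos hb, mul_zero]

/-- `𝔣` is smooth. [folklore] -/
theorem contDiff_fiRad (M : ℝ) {n : ℕ∞} : ContDiff ℝ n (fiRad M) := by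
  unfold fiRad
  refine ContDiff.mul ?_ ?_
  · exact Real.smoothTransition.contDiff.comp
      (((contDiff_const.mul contDiff_id).sub contDiff_const).div_const _)
  · exact Real.smoothTransition.contDiff.comp ((contDiff_const.sub contDiff_id).div_const _)

/-! ### The dispersion sum `𝒟(M, N)` -/

/-- The inner sum of (5.18): `S(w) = Σ_z β_z 𝔷(Re w̄ z)` with `β_z` of (5.13) under the conventions
(5.7)–(5.9), i.e. `Σ_{N' < n ≤ (1+θ)N'} β(n) Σ_{z primary, z ≡ z₀ (8), |z|² = n} q(arg z) 𝔷(Re w̄ z)`,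
`β = fiBeta p C P τ`. [cite: FriedlanderIwaniecAnnals1998, (5.18) with (5.13)] -/
def fiSectorInner (q p : ℝ → ℝ) (z₀ : GaussianInt) (N' θ C P τ : ℝ) (w : GaussianInt) : ℝ :=
  ∑ n ∈ Ioc ⌊N'⌋₊ ⌊(1 + θ) * N'⌋₊, fiBeta p C P τ n *
    ∑ z ∈ (primaryNormEq n).filter (GaussCongrEight z₀), q (gaussArg z) * (fiZeta (star w * z).re : ℝ)

/-- FI (5.18): `𝒟(M, N) = Σ_w f(w) |Σ_z β_z 𝔷(Re w̄ z)|²` with the radial majorant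
`f(w) = fiRad M (|w|²)`, the sum over `w` grouped by `m = |w|² ≤ 4M`.
[cite: FriedlanderIwaniecAnnals1998, (5.18)-(5.19)] -/
def fiDispersion (q p : ℝ → ℝ) (z₀ : GaussianInt) (M N' θ C P τ : ℝ) : ℝ :=
  ∑ m ∈ range (⌊4 * M⌋₊ + 1), fiRad M m *
    ∑ uv ∈ sqPairs m, fiSectorInner q p z₀ N' θ C P τ (toGauss uv) ^ 2

/-- `𝒟(M, N) ≥ 0`. [folklore] -/
theorem fiDispersion_nonneg (q p : ℝ → ℝ) (z₀ : GaussianInt) (M N' θ C P τ : ℝ) :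
    0 ≤ fiDispersion q p z₀ M N' θ C P τ :=
  sum_nonneg fun _ _ => mul_nonneg (fiRad_nonneg _ _) (sum_nonneg fun _ _ => sq_nonneg _)

/-! ### The regime of §§4–5 as predicates -/

/-- The ranges of the parameters in (5.15)/(4.23): (4.4) for `P`, (4.6) for `N` (with exponent `B`),
`x (log x)^{-A₁} < MN < x` for `M`, `1 ≤ C ≤ N^{1-η}`, `N < N' < 2N`.
[cite: FriedlanderIwaniecAnnals1998, (4.4), (4.6), (4.19), Proposition 4.1, (4.12)] -/
structure FISectorRegime (η A₁ B x P N M C N' : ℝ) : Prop where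
  /-- `P > 0` (the sieving parameter of (2.15), (4.4) is a positive real; with Lean's `Real.log`,
  which is even, the two logarithmic bounds alone would also admit `P ≤ -exp((log log x)²)`, for
  which the support condition "all prime factors `≥ P`" is vacuous — a case the source does not
  treat and §5 (5.24) excludes). -/
  P_pos : 0 < P
  logP_ge : Real.log (Real.log x) ^ 2 ≤ Real.log P
  logP_le : Real.log P ≤ Real.log x * (Real.log (Real.log x))⁻¹ ^ 2
  N_gt : x ^ (1 / 4 + η : ℝ) < N
  N_lt : N < x ^ (1 / 2 : ℝ) / Real.log x ^ B
  MN_gt : x / Real.log x ^ A₁ < M * N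
  MN_lt : M * N < x
  C_ge : 1 ≤ C
  C_le : C ≤ N ^ (1 - η : ℝ)
  N'_gt : N < N'
  N'_lt : N' < 2 * N

/-- The conditions (4.12)–(4.14) on the partition function `p` (normalised): `C²`, supported in
`(N', (1+θ)N']`, `|p| ≤ 1`, `|p'| ≤ (θN)⁻¹`, `|p''| ≤ (θN)⁻²`.
[cite: FriedlanderIwaniecAnnals1998, (4.12)-(4.14)] -/
structure FICutoff (θ N N' : ℝ) (p : ℝ → ℝ) : Prop where
  smooth : ContDiff ℝ 2 p
  supp : ∀ u, p u ≠ 0 → N' < u ∧ u ≤ (1 + θ) * N'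
  bound : ∀ u, |p u| ≤ 1
  deriv_bound : ∀ u, |deriv p u| ≤ (θ * N)⁻¹
  deriv2_bound : ∀ u, |deriv (deriv p) u| ≤ (θ * N)⁻¹ ^ 2

/-- The conditions (5.12)–(5.13) on the sector and its cutoff `q` (normalised): the sector
`(φ, φ + 2πθ]` lies in an open quadrant at angular distance `> πϑ` from both axes, `q` is `C²`,
`2π`-periodic, supported on the sector modulo `2π`, `|q| ≤ 1`, `|q'| ≤ θ⁻¹`, `|q''| ≤ θ⁻²`.
[cite: FriedlanderIwaniecAnnals1998, (5.12)-(5.14) and the paragraph after (5.16)] -/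
structure FISectorCutoff (ϑ θ φ : ℝ) (q : ℝ → ℝ) : Prop where
  away : ∃ k : ℤ, k * (π / 2) + π * ϑ < φ ∧ φ + 2 * π * θ < (k + 1) * (π / 2) - π * ϑ
  smooth : ContDiff ℝ 2 q
  periodic : Function.Periodic q (2 * π)
  supp : ∀ u, q u ≠ 0 → ∃ k : ℤ, φ < u - 2 * π * k ∧ u - 2 * π * k ≤ φ + 2 * π * θ
  bound : ∀ u, |q u| ≤ 1
  deriv_bound : ∀ u, |deriv q u| ≤ θ⁻¹
  deriv2_bound : ∀ u, |deriv (deriv q) u| ≤ θ⁻¹ ^ 2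

/-- (5.15) in the regime `(η, A, A₁)` with the parameters `A'` (`θ = (log x)^{-A'}`), `t`
(`τ = (log x)^t`), `B` (in (4.6)) and the constant `K`: for all large `x` and all data in the regime,
`‖B(M, N)‖ ≤ K ϑ θ² (MN)^{3/4} (log MN)⁴`; (5.15) as used for (4.23) is the statement
`∀ η A A₁ > 0, ∃ A' ≥ 2A + 2^20, t ≥ A + 124, B > 0, K > 0` with this property.
[cite: FriedlanderIwaniecAnnals1998, (5.15)] -/
def Bilinear515With (η A A₁ A' t B K : ℝ) : Prop :=
  ∀ᶠ x : ℝ in atTop, ∀ P N M C N' : ℝ, FISectorRegime η A₁ B x P N M C N' →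
    ∀ p : ℝ → ℝ, FICutoff (Real.log x ^ (-A')) N N' p →
    ∀ z₀ : GaussianInt, ∀ φ : ℝ, ∀ q : ℝ → ℝ,
      FISectorCutoff (Real.log x ^ (-A)) (Real.log x ^ (-A')) φ q →
    ∀ α : ℕ → ℂ, (∀ m, ‖α m‖ ≤ 1) →
      ‖fiGaussSector α q p z₀ M N' (Real.log x ^ (-A')) C P (Real.log x ^ t)‖ ≤
        K * Real.log x ^ (-A) * (Real.log x ^ (-A')) ^ 2 * (M * N) ^ (3 / 4 : ℝ) *
          Real.log (M * N) ^ 4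

/-- (5.20) in the regime `(η, A, A₁)` with the parameters `A', t, B` and the constant `K`: for all
large `x` and all data in the regime, `𝒟(M, N) ≤ K ϑ² θ⁴ M^{1/2} N^{3/2} (log MN)⁸`, `𝒟(M, N)` being
(5.18) with the majorant `fiRad` (`fiDispersion`). This is the input of the Cauchy step, proved in
§§5–26 of the source. [cite: FriedlanderIwaniecAnnals1998, (5.20)] -/
def DispersionBoundWith (η A A₁ A' t B K : ℝ) : Prop :=
  ∀ᶠ x : ℝ in atTop, ∀ P N M C N' : ℝ, FISectorRegime η A₁ B x P N M C N' →
    ∀ p : ℝ → ℝ, FICutoff (Real.log x ^ (-A')) N N' p →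
    ∀ z₀ : GaussianInt, ∀ φ : ℝ, ∀ q : ℝ → ℝ,
      FISectorCutoff (Real.log x ^ (-A)) (Real.log x ^ (-A')) φ q →
      fiDispersion q p z₀ M N' (Real.log x ^ (-A')) C P (Real.log x ^ t) ≤
        K * (Real.log x ^ (-A)) ^ 2 * (Real.log x ^ (-A')) ^ 4 *
          (M ^ (1 / 2 : ℝ) * N ^ (3 / 2 : ℝ)) * Real.log (M * N) ^ 8

/-! ### Cauchy's inequality (5.17) -/

/-- `B(M, N) = Σ_{M < m ≤ 2M} α(m) Σ_{|w|² = m} S(w)` with `S = fiSectorInner`: the free sector form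
regrouped with the `z`-sum innermost. [cite: FriedlanderIwaniecAnnals1998, (5.17)-(5.18)] -/
theorem fiGaussSector_eq_sum_inner (α : ℕ → ℂ) (q p : ℝ → ℝ) (z₀ : GaussianInt)
    (M N' θ C P τ : ℝ) :
    fiGaussSector α q p z₀ M N' θ C P τ = ∑ m ∈ Ioc ⌊M⌋₊ ⌊2 * M⌋₊,
      α m * ((∑ uv ∈ sqPairs m, fiSectorInner q p z₀ N' θ C P τ (toGauss uv) : ℝ) : ℂ) := by
  rw [fiGaussSector_def]
  refine sum_congr rfl fun m _ => ?_
  have key : (∑ uv ∈ sqPairs m, fiSectorInner q p z₀ N' θ C P τ (toGauss uv)) =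
      ∑ n ∈ Ioc ⌊N'⌋₊ ⌊(1 + θ) * N'⌋₊, fiBeta p C P τ n *
        ∑ uv ∈ sqPairs m, ∑ z ∈ (primaryNormEq n).filter (GaussCongrEight z₀),
          q (gaussArg z) * (fiZeta (star (toGauss uv) * z).re : ℝ) := by
    unfold fiSectorInner
    rw [sum_comm]
    refine sum_congr rfl fun n _ => ?_
    rw [mul_sum]
  rw [key, Complex.ofReal_sum, mul_sum]
  refine sum_congr rfl fun n _ => ?_
  push_cast
  ring

/-- The lattice points on the circles `|w|² = m`, `M < m ≤ 2M`, are at most `15 M` in number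
(`M ≥ 1`): they lie in the square `[-R, R]²`, `R = ⌊√(2M)⌋`. [folklore] -/
theorem sum_card_sqPairs_le {M : ℝ} (hM : 1 ≤ M) :
    (∑ m ∈ Ioc ⌊M⌋₊ ⌊2 * M⌋₊, (#(sqPairs m) : ℝ)) ≤ 15 * M := by
  set R : ℕ := Nat.sqrt ⌊2 * M⌋₊ with hR
  have hdisj : ((Ioc ⌊M⌋₊ ⌊2 * M⌋₊ : Finset ℕ) : Set ℕ).PairwiseDisjoint sqPairs := by
    intro a _ b _ hab
    refine Finset.disjoint_left.mpr fun uv hua hub => hab ?_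
    have ha := mem_sqPairs.mp hua
    have hb := mem_sqPairs.mp hub
    exact_mod_cast ha.symm.trans hb
  have hsub : (Ioc ⌊M⌋₊ ⌊2 * M⌋₊).biUnion sqPairs ⊆ Icc (-(R : ℤ)) R ×ˢ Icc (-(R : ℤ)) R := by
    intro uv huv
    obtain ⟨m, hm, hmem⟩ := mem_biUnion.mp huv
    have h := mem_sqPairs.mp hmem
    have hm2 : m ≤ ⌊2 * M⌋₊ := (mem_Ioc.mp hm).2
    have hb : ∀ u : ℤ, u ^ 2 ≤ (m : ℤ) → u ∈ Icc (-(R : ℤ)) R := by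
      intro u hu
      have h1 : u.natAbs ^ 2 ≤ ⌊2 * M⌋₊ := by
        have : ((u.natAbs ^ 2 : ℕ) : ℤ) ≤ (⌊2 * M⌋₊ : ℕ) := by
          push_cast; rw [sq_abs]; exact hu.trans (by exact_mod_cast hm2)
        exact_mod_cast this
      have h2 : u.natAbs ≤ R := by
        rw [hR, Nat.le_sqrt']; exact h1
      rw [mem_Icc]; omega
    exact mem_product.mpr
      ⟨hb uv.1 (by nlinarith [sq_nonneg uv.2]), hb uv.2 (by nlinarith [sq_nonneg uv.1])⟩
  have hcard : (∑ m ∈ Ioc ⌊M⌋₊ ⌊2 * M⌋₊, #(sqPairs m)) ≤ (2 * R + 1) ^ 2 := by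
    rw [← card_biUnion hdisj]
    refine (card_le_card hsub).trans ?_
    rw [card_product, Int.card_Icc]
    have : (R : ℤ) + 1 - -(R : ℤ) = ((2 * R + 1 : ℕ) : ℤ) := by push_cast; ring
    rw [this, Int.toNat_natCast, sq]
  have hRle : (R : ℝ) ≤ Real.sqrt (2 * M) := by
    have h1 : ((R * R : ℕ) : ℝ) ≤ ⌊2 * M⌋₊ := by exact_mod_cast Nat.sqrt_le ⌊2 * M⌋₊
    have h2 : (⌊2 * M⌋₊ : ℝ) ≤ 2 * M := Nat.floor_le (by linarith)
    have h3 : (R : ℝ) ^ 2 ≤ 2 * M := by rw [sq]; push_cast at h1; linarith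
    exact Real.le_sqrt_of_sq_le h3
  have hsM : 1 ≤ Real.sqrt M := by
    rw [show (1 : ℝ) = Real.sqrt 1 from Real.sqrt_one.symm]
    exact Real.sqrt_le_sqrt hM
  have hs2 : Real.sqrt (2 * M) = Real.sqrt 2 * Real.sqrt M := Real.sqrt_mul (by norm_num) M
  have hsqrt2 : Real.sqrt 2 ≤ 3 / 2 := by
    rw [Real.sqrt_le_left (by norm_num)]; norm_num
  have hRle' : (R : ℝ) ≤ Real.sqrt 2 * Real.sqrt M := hs2 ▸ hRle
  calc (∑ m ∈ Ioc ⌊M⌋₊ ⌊2 * M⌋₊, (#(sqPairs m) : ℝ))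
      = ((∑ m ∈ Ioc ⌊M⌋₊ ⌊2 * M⌋₊, #(sqPairs m) : ℕ) : ℝ) := by push_cast; rfl
    _ ≤ ((2 * R + 1) ^ 2 : ℕ) := by exact_mod_cast hcard
    _ = (2 * (R : ℝ) + 1) ^ 2 := by push_cast; ring
    _ ≤ (2 * (Real.sqrt 2 * Real.sqrt M) + Real.sqrt M) ^ 2 := by gcongr
    _ = (2 * Real.sqrt 2 + 1) ^ 2 * M := by
        rw [show 2 * (Real.sqrt 2 * Real.sqrt M) + Real.sqrt M = (2 * Real.sqrt 2 + 1) * Real.sqrt M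
          by ring, mul_pow, Real.sq_sqrt (by linarith)]
    _ ≤ 15 * M := by
        gcongr
        nlinarith [Real.sqrt_nonneg 2, Real.sq_sqrt (show (0 : ℝ) ≤ 2 by norm_num)]

/-- **FI (5.17) (Cauchy's inequality with the smooth majorant).** For `M ≥ 1` and `|α| ≤ 1`,
`‖B(M, N)‖² ≤ 15 M 𝒟(M, N)`. [cite: FriedlanderIwaniecAnnals1998, (5.17)-(5.19)] -/
theorem norm_fiGaussSector_sq_le {α : ℕ → ℂ} (hα : ∀ m, ‖α m‖ ≤ 1) (q p : ℝ → ℝ)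
    (z₀ : GaussianInt) {M : ℝ} (hM : 1 ≤ M) (N' θ C P τ : ℝ) :
    ‖fiGaussSector α q p z₀ M N' θ C P τ‖ ^ 2 ≤ 15 * M * fiDispersion q p z₀ M N' θ C P τ := by
  set S : ℤ × ℤ → ℝ := fun uv => fiSectorInner q p z₀ N' θ C P τ (toGauss uv) with hS
  set I : Finset ℕ := Ioc ⌊M⌋₊ ⌊2 * M⌋₊ with hI
  have hM0 : 0 < M := by linarith
  -- Step 1: ‖B‖ ≤ Σ_m Σ_uv |S uv|
  have h1 : ‖fiGaussSector α q p z₀ M N' θ C P τ‖ ≤ ∑ m ∈ I, ∑ uv ∈ sqPairs m, |S uv| := by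
    rw [fiGaussSector_eq_sum_inner]
    refine (norm_sum_le _ _).trans (sum_le_sum fun m _ => ?_)
    rw [norm_mul, Complex.norm_real, Real.norm_eq_abs]
    calc ‖α m‖ * |∑ uv ∈ sqPairs m, fiSectorInner q p z₀ N' θ C P τ (toGauss uv)|
        ≤ 1 * ∑ uv ∈ sqPairs m, |S uv| :=
          mul_le_mul (hα m) (abs_sum_le_sum_abs _ _) (abs_nonneg _) zero_le_one
      _ = _ := one_mul _
  -- Step 2: Cauchy–Schwarz on the sigma set
  have h2 : (∑ m ∈ I, ∑ uv ∈ sqPairs m, |S uv|) ^ 2 ≤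
      (∑ m ∈ I, (#(sqPairs m) : ℝ)) * ∑ m ∈ I, ∑ uv ∈ sqPairs m, S uv ^ 2 := by
    have hcs := sum_mul_sq_le_sq_mul_sq (I.sigma fun m => sqPairs m) (fun _ => (1 : ℝ))
      (fun x => |S x.2|)
    simp only [one_pow, one_mul, sq_abs] at hcs
    rw [sum_sigma, sum_sigma, sum_sigma] at hcs
    simpa [sum_const, nsmul_eq_mul, mul_one] using hcs
  -- Step 3: the diagonal sum is bounded by 𝒟
  have h3 : (∑ m ∈ I, ∑ uv ∈ sqPairs m, S uv ^ 2) ≤ fiDispersion q p z₀ M N' θ C P τ := by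
    unfold fiDispersion
    have hsub : I ⊆ range (⌊4 * M⌋₊ + 1) := by
      intro m hm
      rw [hI, mem_Ioc] at hm
      have : m ≤ ⌊4 * M⌋₊ := hm.2.trans (Nat.floor_le_floor (by linarith))
      exact mem_range.mpr (by omega)
    have heq : ∀ m ∈ I, ∑ uv ∈ sqPairs m, S uv ^ 2 =
        fiRad M m * ∑ uv ∈ sqPairs m, fiSectorInner q p z₀ N' θ C P τ (toGauss uv) ^ 2 := by
      intro m hm
      rw [hI, mem_Ioc] at hm
      have hm1 : M / 2 ≤ (m : ℝ) := by
        have : (⌊M⌋₊ : ℝ) + 1 ≤ m := by exact_mod_cast hm.1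
        linarith [Nat.lt_floor_add_one M]
      have hm2 : (m : ℝ) ≤ 2 * M := by
        have : (m : ℝ) ≤ ⌊2 * M⌋₊ := by exact_mod_cast hm.2
        exact this.trans (Nat.floor_le (by linarith))
      rw [fiRad_eq_one hM0 hm1 hm2, one_mul]
    rw [sum_congr rfl heq]
    refine sum_le_sum_of_subset_of_nonneg hsub fun m _ _ => ?_
    exact mul_nonneg (fiRad_nonneg _ _) (sum_nonneg fun _ _ => sq_nonneg _)
  calc ‖fiGaussSector α q p z₀ M N' θ C P τ‖ ^ 2
      ≤ (∑ m ∈ I, ∑ uv ∈ sqPairs m, |S uv|) ^ 2 := by gcongr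
    _ ≤ (∑ m ∈ I, (#(sqPairs m) : ℝ)) * ∑ m ∈ I, ∑ uv ∈ sqPairs m, S uv ^ 2 := h2
    _ ≤ 15 * M * fiDispersion q p z₀ M N' θ C P τ := by
        refine mul_le_mul (sum_card_sqPairs_le hM) h3
          (sum_nonneg fun _ _ => sum_nonneg fun _ _ => sq_nonneg _) (by linarith)

/-! ### (5.15) from (5.20) -/

/-- A power of `log x` is eventually below `√x`. [folklore] -/
theorem eventually_log_rpow_le_sqrt (r : ℝ) :
    ∀ᶠ x : ℝ in atTop, Real.log x ^ r ≤ x ^ (1 / 2 : ℝ) := by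
  have := (isLittleO_log_rpow_rpow_atTop r (by norm_num : (0 : ℝ) < 1 / 2)).bound zero_lt_one
  filter_upwards [this, eventually_gt_atTop 1] with x hx hx1
  rw [one_mul, Real.norm_of_nonneg (Real.rpow_nonneg (Real.log_nonneg hx1.le) _),
    Real.norm_of_nonneg (Real.rpow_nonneg (by linarith) _)] at hx
  exact hx

/-- In the regime of (5.15), `M ≥ 1`, `MN ≥ 1` and `N > 0` once `x` is large:
`MN > x (log x)^{-A₁} ≥ √x` and `M > √x (log x)^{B - A₁} ≥ 1`. [folklore] -/
theorem eventually_one_le_M (η A₁ B : ℝ) :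
    ∀ᶠ x : ℝ in atTop, ∀ P N M C N' : ℝ, FISectorRegime η A₁ B x P N M C N' →
      1 ≤ M ∧ 1 ≤ M * N ∧ 0 < N := by
  filter_upwards [eventually_log_rpow_le_sqrt A₁, eventually_log_rpow_le_sqrt |A₁ - B|,
    eventually_ge_atTop (Real.exp 1)] with x hx1 hx2 hxe P N M C N' hr
  have hx1' : 1 < x := lt_of_lt_of_le (by linarith [Real.add_one_le_exp (1 : ℝ)]) hxe
  have hx0 : 0 < x := by linarith
  have hlog1 : 1 ≤ Real.log x := by rwa [Real.le_log_iff_exp_le hx0]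
  have hlog : 0 < Real.log x := by linarith
  have hxh : 0 < x ^ (1 / 2 : ℝ) := Real.rpow_pos_of_pos hx0 _
  have hxh1 : 1 ≤ x ^ (1 / 2 : ℝ) := Real.one_le_rpow hx1'.le (by norm_num)
  have hxx : x = x ^ (1 / 2 : ℝ) * x ^ (1 / 2 : ℝ) := by
    rw [← Real.rpow_add hx0]; norm_num
  have hN0 : 0 < N := lt_trans (Real.rpow_pos_of_pos hx0 _) hr.N_gt
  have hpA := Real.rpow_pos_of_pos hlog A₁
  have hpB := Real.rpow_pos_of_pos hlog B
  have hMN : 1 ≤ M * N := by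
    have h : x ^ (1 / 2 : ℝ) ≤ x / Real.log x ^ A₁ := by
      rw [le_div_iff₀ hpA]
      calc x ^ (1 / 2 : ℝ) * Real.log x ^ A₁ ≤ x ^ (1 / 2 : ℝ) * x ^ (1 / 2 : ℝ) := by gcongr
        _ = x := hxx.symm
    linarith [hr.MN_gt]
  refine ⟨?_, hMN, hN0⟩
  by_contra hM
  rw [not_le] at hM
  have hMN' : M * N < N := by nlinarith
  have hlt : x / Real.log x ^ A₁ < x ^ (1 / 2 : ℝ) / Real.log x ^ B :=
    hr.MN_gt.trans (hMN'.trans hr.N_lt)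
  rw [div_lt_div_iff₀ hpA hpB] at hlt
  -- hlt : x * log^B < x^{1/2} * log^{A₁}
  have h3 : x ^ (1 / 2 : ℝ) * Real.log x ^ B < Real.log x ^ A₁ := by
    have : x ^ (1 / 2 : ℝ) * (x ^ (1 / 2 : ℝ) * Real.log x ^ B) < x ^ (1 / 2 : ℝ) * Real.log x ^ A₁ := by
      calc x ^ (1 / 2 : ℝ) * (x ^ (1 / 2 : ℝ) * Real.log x ^ B) = x * Real.log x ^ B := by
            rw [← mul_assoc, ← hxx]
        _ < _ := hlt
    exact lt_of_mul_lt_mul_left this hxh.le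
  have hAB : Real.log x ^ A₁ = Real.log x ^ (A₁ - B) * Real.log x ^ B := by
    rw [← Real.rpow_add hlog]; ring_nf
  rw [hAB] at h3
  have h4 : x ^ (1 / 2 : ℝ) < Real.log x ^ (A₁ - B) := lt_of_mul_lt_mul_right h3 hpB.le
  have h5 : Real.log x ^ (A₁ - B) ≤ Real.log x ^ |A₁ - B| :=
    Real.rpow_le_rpow_of_exponent_le hlog1 (le_abs_self _)
  linarith

/-- **(5.15) from (5.20), parametrised form.** If `𝒟(M, N) ≤ K ϑ² θ⁴ M^{1/2} N^{3/2} (log MN)⁸`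
throughout the regime, then `‖B(M, N)‖ ≤ √(15K) ϑ θ² (MN)^{3/4} (log MN)⁴` throughout the regime
((5.17): `‖B‖² ≤ 15 M 𝒟`). [cite: FriedlanderIwaniecAnnals1998, (5.15)-(5.20)] -/
theorem bilinear515With_of_dispersionBoundWith {η A A₁ A' t B K : ℝ} (hK : 0 ≤ K)
    (h : DispersionBoundWith η A A₁ A' t B K) :
    Bilinear515With η A A₁ A' t B (Real.sqrt (15 * K)) := by
  unfold DispersionBoundWith at h
  unfold Bilinear515With
  filter_upwards [h, eventually_one_le_M η A₁ B, eventually_gt_atTop 1] with x hx hM1 hx1 P N M C N'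
    hr p hp z₀ φ q hq α hα
  obtain ⟨hM, hMN, hN⟩ := hM1 P N M C N' hr
  have hD := hx P N M C N' hr p hp z₀ φ q hq
  have hCS := norm_fiGaussSector_sq_le hα q p z₀ hM N' (Real.log x ^ (-A')) C P (Real.log x ^ t)
  set θ := Real.log x ^ (-A') with hθ
  set ϑ := Real.log x ^ (-A) with hϑ
  have hlog : 0 < Real.log x := Real.log_pos hx1
  have hθ0 : 0 < θ := Real.rpow_pos_of_pos hlog _
  have hϑ0 : 0 < ϑ := Real.rpow_pos_of_pos hlog _
  have hM0 : 0 < M := by linarith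
  have hL : 0 ≤ Real.log (M * N) := Real.log_nonneg hMN
  set L := Real.log (M * N) with hLdef
  have e1 : ((M * N) ^ (3 / 4 : ℝ)) ^ 2 = (M * N) * (M ^ (1 / 2 : ℝ) * N ^ (1 / 2 : ℝ)) := by
    rw [← Real.rpow_two, ← Real.rpow_mul (by positivity)]
    norm_num
    rw [show (3 / 2 : ℝ) = 1 + 1 / 2 by norm_num, Real.rpow_add (by positivity), Real.rpow_one,
      Real.mul_rpow hM0.le hN.le]
  have e2 : N ^ (3 / 2 : ℝ) = N * N ^ (1 / 2 : ℝ) := by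
    rw [show (3 / 2 : ℝ) = 1 + 1 / 2 by norm_num, Real.rpow_add hN, Real.rpow_one]
  have hsq : (Real.sqrt (15 * K) * ϑ * θ ^ 2 * (M * N) ^ (3 / 4 : ℝ) * L ^ 4) ^ 2 =
      15 * M * (K * ϑ ^ 2 * θ ^ 4 * (M ^ (1 / 2 : ℝ) * N ^ (3 / 2 : ℝ)) * L ^ 8) := by
    rw [mul_pow, mul_pow, mul_pow, mul_pow, Real.sq_sqrt (by positivity), e1, e2]
    ring
  have hrhs0 : 0 ≤ Real.sqrt (15 * K) * ϑ * θ ^ 2 * (M * N) ^ (3 / 4 : ℝ) * L ^ 4 := by positivity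
  have hfin : ‖fiGaussSector α q p z₀ M N' θ C P (Real.log x ^ t)‖ ^ 2 ≤
      (Real.sqrt (15 * K) * ϑ * θ ^ 2 * (M * N) ^ (3 / 4 : ℝ) * L ^ 4) ^ 2 := by
    rw [hsq]
    calc ‖fiGaussSector α q p z₀ M N' θ C P (Real.log x ^ t)‖ ^ 2
        ≤ 15 * M * fiDispersion q p z₀ M N' θ C P (Real.log x ^ t) := hCS
      _ ≤ 15 * M * (K * ϑ ^ 2 * θ ^ 4 * (M ^ (1 / 2 : ℝ) * N ^ (3 / 2 : ℝ)) * L ^ 8) := by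
          gcongr
  calc ‖fiGaussSector α q p z₀ M N' θ C P (Real.log x ^ t)‖
      = Real.sqrt (‖fiGaussSector α q p z₀ M N' θ C P (Real.log x ^ t)‖ ^ 2) :=
        (Real.sqrt_sq (norm_nonneg _)).symm
    _ ≤ Real.sqrt ((Real.sqrt (15 * K) * ϑ * θ ^ 2 * (M * N) ^ (3 / 4 : ℝ) * L ^ 4) ^ 2) :=
        Real.sqrt_le_sqrt hfin
    _ = Real.sqrt (15 * K) * ϑ * θ ^ 2 * (M * N) ^ (3 / 4 : ℝ) * L ^ 4 := Real.sqrt_sq hrhs0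

/-- **FI (5.15) from (5.20).** If for every `η, A, A₁ > 0` there are `A' ≥ 2A + 2^20`,
`t ≥ A + 124`, `B > 0`, `K > 0` with `𝒟(M, N) ≤ K ϑ² θ⁴ M^{1/2} N^{3/2} (log MN)⁸` throughout the
regime ((5.20), `DispersionBoundWith`), then (5.15) holds in the same form: for every `η, A, A₁ > 0`
there are such `A', t, B` and a `K > 0` with `‖B(M, N)‖ ≤ K ϑ θ² (MN)^{3/4} (log MN)⁴` throughout the
regime (`Bilinear515With`) — the shape in which a reduction of (4.23) (the hypothesis `BilinBoundAt` of
`FriedlanderIwaniec1998_prop41_of_bilinear423`) to (5.15) consumes it.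
[cite: FriedlanderIwaniecAnnals1998, (5.15)-(5.20)] -/
theorem bilinear515_of_dispersion
    (h : ∀ η : ℝ, 0 < η → ∀ A : ℝ, 0 < A → ∀ A₁ : ℝ, 0 < A₁ →
      ∃ A' t B K : ℝ, 2 * A + 2 ^ 20 ≤ A' ∧ A + 124 ≤ t ∧ 0 < B ∧ 0 < K ∧
        DispersionBoundWith η A A₁ A' t B K) :
    ∀ η : ℝ, 0 < η → ∀ A : ℝ, 0 < A → ∀ A₁ : ℝ, 0 < A₁ →
      ∃ A' t B K : ℝ, 2 * A + 2 ^ 20 ≤ A' ∧ A + 124 ≤ t ∧ 0 < B ∧ 0 < K ∧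
        Bilinear515With η A A₁ A' t B K := by
  intro η hη A hA A₁ hA₁
  obtain ⟨A', t, B, K, hA', ht, hB, hK, hD⟩ := h η hη A hA A₁ hA₁
  exact ⟨A', t, B, Real.sqrt (15 * K), hA', ht, hB, Real.sqrt_pos.mpr (by positivity),
    bilinear515With_of_dispersionBoundWith hK.le hD⟩

/-- `Bilinear515With` unbundled: the statement with the quantifier prefix written out as in
`BilinBoundAt` (`…BilinearReduction`; for `P, N, M, C, N', p, z₀, φ, q, α` separately).
[cite: FriedlanderIwaniecAnnals1998, (5.15)] -/
theorem Bilinear515With.apply {η A A₁ A' t B K : ℝ} (h : Bilinear515With η A A₁ A' t B K) :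
    ∀ᶠ x : ℝ in atTop,
      ∀ P : ℝ, 0 < P → Real.log (Real.log x) ^ 2 ≤ Real.log P →
        Real.log P ≤ Real.log x * (Real.log (Real.log x))⁻¹ ^ 2 →
      ∀ N : ℝ, x ^ (1 / 4 + η : ℝ) < N → N < x ^ (1 / 2 : ℝ) / Real.log x ^ B →
      ∀ M : ℝ, x / Real.log x ^ A₁ < M * N → M * N < x →
      ∀ C : ℝ, 1 ≤ C → C ≤ N ^ (1 - η : ℝ) →
      ∀ N' : ℝ, N < N' → N' < 2 * N →
      ∀ p : ℝ → ℝ, ContDiff ℝ 2 p →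
        (∀ u, p u ≠ 0 → N' < u ∧ u ≤ (1 + Real.log x ^ (-A')) * N') →
        (∀ u, |p u| ≤ 1) →
        (∀ u, |deriv p u| ≤ (Real.log x ^ (-A') * N)⁻¹) →
        (∀ u, |deriv (deriv p) u| ≤ (Real.log x ^ (-A') * N)⁻¹ ^ 2) →
      ∀ z₀ : GaussianInt,
      ∀ φ : ℝ, (∃ k : ℤ, k * (π / 2) + π * Real.log x ^ (-A) < φ ∧
          φ + 2 * π * Real.log x ^ (-A') < (k + 1) * (π / 2) - π * Real.log x ^ (-A)) →
      ∀ q : ℝ → ℝ, ContDiff ℝ 2 q → Function.Periodic q (2 * π) →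
        (∀ u, q u ≠ 0 → ∃ k : ℤ, φ < u - 2 * π * k ∧ u - 2 * π * k ≤ φ + 2 * π * Real.log x ^ (-A')) →
        (∀ u, |q u| ≤ 1) →
        (∀ u, |deriv q u| ≤ (Real.log x ^ (-A'))⁻¹) →
        (∀ u, |deriv (deriv q) u| ≤ (Real.log x ^ (-A'))⁻¹ ^ 2) →
      ∀ α : ℕ → ℂ, (∀ m, ‖α m‖ ≤ 1) →
        ‖fiGaussSector α q p z₀ M N' (Real.log x ^ (-A')) C P (Real.log x ^ t)‖ ≤
          K * Real.log x ^ (-A) * (Real.log x ^ (-A')) ^ 2 * (M * N) ^ (3 / 4 : ℝ) *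
            Real.log (M * N) ^ 4 := by
  filter_upwards [h] with x hx P hP0 hP1 hP2 N hN1 hN2 M hM1 hM2 C hC1 hC2 N' hN'1 hN'2 p hp1 hp2 hp3
    hp4 hp5 z₀ φ hφ q hq1 hq2 hq3 hq4 hq5 hq6 α hα
  exact hx P N M C N' ⟨hP0, hP1, hP2, hN1, hN2, hM1, hM2, hC1, hC2, hN'1, hN'2⟩ p
    ⟨hp1, hp2, hp3, hp4, hp5⟩ z₀ φ q ⟨hφ, hq1, hq2, hq3, hq4, hq5, hq6⟩ α hα

end FriedlanderIwaniecPrimes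

end Literature.NumberTheory.Sieve
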